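import Summits.CriticalPhenomena.PercolationContinuityZ3.Theorems.Transplant.FKConnectivityAllQPat3KNetDefs
import HarnessLib

/-!
# Connectivity correlation inequalities for `φ_{w,q}`, every `q > 0` — the class 𝒦: a `K₄` with six 𝒦-slots (`FK.K4Sep`)

Definition file (`--supports stmt-CriticalPhenomena-4575`), census lineage (gen 41) of LANE 2's FK sub-programme; builds on p205010 (kernel
theorem, internal audit signed; external expert review pending).  One structure (in `Prop`) + its symmetries; no sorries; standard axioms.

The common setting of ALL the K-state leaves of THEOREM SP(𝒦)'s inner recursion (census g41 drafts/README, the 12 leaf specs of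
«…KNetSPLeavesI»): the side `E₁ = BRIDGE(Qac, Qad, Qbc, Qbd, Qcd; x, y)` in parallel with a 𝒦-network `E₂` between `x, y` is a `K₄` on the
corners `x, y, c, d` whose SIX slots (`Qxy := E₂` and the five bridge slots) are 𝒦-networks, pairwise edge-disjoint, with vertex sets meeting
only in common corners.  `FK.K4Sep` records these side conditions (census g41 «Pat3KNetDefs» `FK.BridgeSep` plus the sixth slot);
`FK.k4Sep_of_bridge_par` builds it; `FK.K4Sep.swap_ab / swap_cd / swap_bc / swap_ac` relabel the corners (they generate all 24 relabelings), so
that ONE placement lemma per leaf shape (VEE*, triangle, claw, path — successor) serves every spec; `FK.K4Sep.toBridgeSep`, `FK.K4Sep.isKNet`.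
[cite: AyyerLinussonRavichandran2025, §7 (p. 22)] [cite: Grimmett2006, §3.9 (pp. 63–64)]
-/

namespace Summit.CriticalPhenomena.PercolationContinuityZ3.Theorems

namespace FK

open scoped Classical

variable {V : Type*}

/-- **Side conditions of a `K₄` with six slots** on the corners `a, b, c, d`: the slots are pairwise edge-disjoint and the vertex
sets of two slots meet only in their common corner (not at all for opposite slots). [folklore] -/
structure K4Sep (Qab Qac Qad Qbc Qbd Qcd : Finset (Sym2 V)) (a b c d : V) : Prop where
  /-- `Qab ∩ Qac = ∅` -/ d_ab_ac : Disjoint Qab Qac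
  /-- `Qab ∩ Qad = ∅` -/ d_ab_ad : Disjoint Qab Qad
  /-- `Qab ∩ Qbc = ∅` -/ d_ab_bc : Disjoint Qab Qbc
  /-- `Qab ∩ Qbd = ∅` -/ d_ab_bd : Disjoint Qab Qbd
  /-- `Qab ∩ Qcd = ∅` -/ d_ab_cd : Disjoint Qab Qcd
  /-- `Qac ∩ Qad = ∅` -/ d_ac_ad : Disjoint Qac Qad
  /-- `Qac ∩ Qbc = ∅` -/ d_ac_bc : Disjoint Qac Qbc
  /-- `Qac ∩ Qbd = ∅` -/ d_ac_bd : Disjoint Qac Qbd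
  /-- `Qac ∩ Qcd = ∅` -/ d_ac_cd : Disjoint Qac Qcd
  /-- `Qad ∩ Qbc = ∅` -/ d_ad_bc : Disjoint Qad Qbc
  /-- `Qad ∩ Qbd = ∅` -/ d_ad_bd : Disjoint Qad Qbd
  /-- `Qad ∩ Qcd = ∅` -/ d_ad_cd : Disjoint Qad Qcd
  /-- `Qbc ∩ Qbd = ∅` -/ d_bc_bd : Disjoint Qbc Qbd
  /-- `Qbc ∩ Qcd = ∅` -/ d_bc_cd : Disjoint Qbc Qcd
  /-- `Qbd ∩ Qcd = ∅` -/ d_bd_cd : Disjoint Qbd Qcd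
  /-- `V(Qab) ∩ V(Qac) ⊆ {a}` -/ v_ab_ac : ∀ z : V, (∃ e ∈ Qab, z ∈ e) → (∃ e ∈ Qac, z ∈ e) → z = a
  /-- `V(Qab) ∩ V(Qad) ⊆ {a}` -/ v_ab_ad : ∀ z : V, (∃ e ∈ Qab, z ∈ e) → (∃ e ∈ Qad, z ∈ e) → z = a
  /-- `V(Qab) ∩ V(Qbc) ⊆ {b}` -/ v_ab_bc : ∀ z : V, (∃ e ∈ Qab, z ∈ e) → (∃ e ∈ Qbc, z ∈ e) → z = b
  /-- `V(Qab) ∩ V(Qbd) ⊆ {b}` -/ v_ab_bd : ∀ z : V, (∃ e ∈ Qab, z ∈ e) → (∃ e ∈ Qbd, z ∈ e) → z = b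
  /-- `V(Qab) ∩ V(Qcd) ⊆ {}` -/ v_ab_cd : ∀ z : V, (∃ e ∈ Qab, z ∈ e) → (∃ e ∈ Qcd, z ∈ e) → False
  /-- `V(Qac) ∩ V(Qad) ⊆ {a}` -/ v_ac_ad : ∀ z : V, (∃ e ∈ Qac, z ∈ e) → (∃ e ∈ Qad, z ∈ e) → z = a
  /-- `V(Qac) ∩ V(Qbc) ⊆ {c}` -/ v_ac_bc : ∀ z : V, (∃ e ∈ Qac, z ∈ e) → (∃ e ∈ Qbc, z ∈ e) → z = c
  /-- `V(Qac) ∩ V(Qbd) ⊆ {}` -/ v_ac_bd : ∀ z : V, (∃ e ∈ Qac, z ∈ e) → (∃ e ∈ Qbd, z ∈ e) → False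
  /-- `V(Qac) ∩ V(Qcd) ⊆ {c}` -/ v_ac_cd : ∀ z : V, (∃ e ∈ Qac, z ∈ e) → (∃ e ∈ Qcd, z ∈ e) → z = c
  /-- `V(Qad) ∩ V(Qbc) ⊆ {}` -/ v_ad_bc : ∀ z : V, (∃ e ∈ Qad, z ∈ e) → (∃ e ∈ Qbc, z ∈ e) → False
  /-- `V(Qad) ∩ V(Qbd) ⊆ {d}` -/ v_ad_bd : ∀ z : V, (∃ e ∈ Qad, z ∈ e) → (∃ e ∈ Qbd, z ∈ e) → z = d
  /-- `V(Qad) ∩ V(Qcd) ⊆ {d}` -/ v_ad_cd : ∀ z : V, (∃ e ∈ Qad, z ∈ e) → (∃ e ∈ Qcd, z ∈ e) → z = d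
  /-- `V(Qbc) ∩ V(Qbd) ⊆ {b}` -/ v_bc_bd : ∀ z : V, (∃ e ∈ Qbc, z ∈ e) → (∃ e ∈ Qbd, z ∈ e) → z = b
  /-- `V(Qbc) ∩ V(Qcd) ⊆ {c}` -/ v_bc_cd : ∀ z : V, (∃ e ∈ Qbc, z ∈ e) → (∃ e ∈ Qcd, z ∈ e) → z = c
  /-- `V(Qbd) ∩ V(Qcd) ⊆ {d}` -/ v_bd_cd : ∀ z : V, (∃ e ∈ Qbd, z ∈ e) → (∃ e ∈ Qcd, z ∈ e) → z = d

section K4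

variable {Qab Qac Qad Qbc Qbd Qcd : Finset (Sym2 V)} {a b c d : V}

/-- Forgetting the slot `ab`: the other five slots satisfy the bridge side conditions on the poles `a, b`. [folklore] -/
theorem K4Sep.toBridgeSep (h : K4Sep Qab Qac Qad Qbc Qbd Qcd a b c d) : BridgeSep Qac Qad Qbc Qbd Qcd a b c d where
  d_ac_ad := h.d_ac_ad
  d_ac_bc := h.d_ac_bc
  d_ac_bd := h.d_ac_bd
  d_ac_cd := h.d_ac_cd
  d_ad_bc := h.d_ad_bc
  d_ad_bd := h.d_ad_bd
  d_ad_cd := h.d_ad_cd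
  d_bc_bd := h.d_bc_bd
  d_bc_cd := h.d_bc_cd
  d_bd_cd := h.d_bd_cd
  v_ac_ad := h.v_ac_ad
  v_ac_bc := h.v_ac_bc
  v_ac_bd := h.v_ac_bd
  v_ac_cd := h.v_ac_cd
  v_ad_bc := h.v_ad_bc
  v_ad_bd := h.v_ad_bd
  v_ad_cd := h.v_ad_cd
  v_bc_bd := h.v_bc_bd
  v_bc_cd := h.v_bc_cd
  v_bd_cd := h.v_bd_cd

/-- Relabeling the corners `a ↔ b`. [folklore] -/
theorem K4Sep.swap_ab (h : K4Sep Qab Qac Qad Qbc Qbd Qcd a b c d) :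
    K4Sep Qab Qbc Qbd Qac Qad Qcd b a c d where
  d_ab_ac := h.d_ab_bc
  d_ab_ad := h.d_ab_bd
  d_ab_bc := h.d_ab_ac
  d_ab_bd := h.d_ab_ad
  d_ab_cd := h.d_ab_cd
  d_ac_ad := h.d_bc_bd
  d_ac_bc := h.d_ac_bc.symm
  d_ac_bd := h.d_ad_bc.symm
  d_ac_cd := h.d_bc_cd
  d_ad_bc := h.d_ac_bd.symm
  d_ad_bd := h.d_ad_bd.symm
  d_ad_cd := h.d_bd_cd
  d_bc_bd := h.d_ac_ad
  d_bc_cd := h.d_ac_cd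
  d_bd_cd := h.d_ad_cd
  v_ab_ac := h.v_ab_bc
  v_ab_ad := h.v_ab_bd
  v_ab_bc := h.v_ab_ac
  v_ab_bd := h.v_ab_ad
  v_ab_cd := h.v_ab_cd
  v_ac_ad := h.v_bc_bd
  v_ac_bc := fun z h₁ h₂ => h.v_ac_bc z h₂ h₁
  v_ac_bd := fun z h₁ h₂ => h.v_ad_bc z h₂ h₁
  v_ac_cd := h.v_bc_cd
  v_ad_bc := fun z h₁ h₂ => h.v_ac_bd z h₂ h₁
  v_ad_bd := fun z h₁ h₂ => h.v_ad_bd z h₂ h₁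
  v_ad_cd := h.v_bd_cd
  v_bc_bd := h.v_ac_ad
  v_bc_cd := h.v_ac_cd
  v_bd_cd := h.v_ad_cd

/-- Relabeling the corners `c ↔ d`. [folklore] -/
theorem K4Sep.swap_cd (h : K4Sep Qab Qac Qad Qbc Qbd Qcd a b c d) :
    K4Sep Qab Qad Qac Qbd Qbc Qcd a b d c where
  d_ab_ac := h.d_ab_ad
  d_ab_ad := h.d_ab_ac
  d_ab_bc := h.d_ab_bd
  d_ab_bd := h.d_ab_bc
  d_ab_cd := h.d_ab_cd
  d_ac_ad := h.d_ac_ad.symm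
  d_ac_bc := h.d_ad_bd
  d_ac_bd := h.d_ad_bc
  d_ac_cd := h.d_ad_cd
  d_ad_bc := h.d_ac_bd
  d_ad_bd := h.d_ac_bc
  d_ad_cd := h.d_ac_cd
  d_bc_bd := h.d_bc_bd.symm
  d_bc_cd := h.d_bd_cd
  d_bd_cd := h.d_bc_cd
  v_ab_ac := h.v_ab_ad
  v_ab_ad := h.v_ab_ac
  v_ab_bc := h.v_ab_bd
  v_ab_bd := h.v_ab_bc
  v_ab_cd := h.v_ab_cd
  v_ac_ad := fun z h₁ h₂ => h.v_ac_ad z h₂ h₁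
  v_ac_bc := h.v_ad_bd
  v_ac_bd := h.v_ad_bc
  v_ac_cd := h.v_ad_cd
  v_ad_bc := h.v_ac_bd
  v_ad_bd := h.v_ac_bc
  v_ad_cd := h.v_ac_cd
  v_bc_bd := fun z h₁ h₂ => h.v_bc_bd z h₂ h₁
  v_bc_cd := h.v_bd_cd
  v_bd_cd := h.v_bc_cd

/-- Relabeling the corners `b ↔ c`. [folklore] -/
theorem K4Sep.swap_bc (h : K4Sep Qab Qac Qad Qbc Qbd Qcd a b c d) :
    K4Sep Qac Qab Qad Qbc Qcd Qbd a c b d where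
  d_ab_ac := h.d_ab_ac.symm
  d_ab_ad := h.d_ac_ad
  d_ab_bc := h.d_ac_bc
  d_ab_bd := h.d_ac_cd
  d_ab_cd := h.d_ac_bd
  d_ac_ad := h.d_ab_ad
  d_ac_bc := h.d_ab_bc
  d_ac_bd := h.d_ab_cd
  d_ac_cd := h.d_ab_bd
  d_ad_bc := h.d_ad_bc
  d_ad_bd := h.d_ad_cd
  d_ad_cd := h.d_ad_bd
  d_bc_bd := h.d_bc_cd
  d_bc_cd := h.d_bc_bd
  d_bd_cd := h.d_bd_cd.symm
  v_ab_ac := fun z h₁ h₂ => h.v_ab_ac z h₂ h₁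
  v_ab_ad := h.v_ac_ad
  v_ab_bc := h.v_ac_bc
  v_ab_bd := h.v_ac_cd
  v_ab_cd := h.v_ac_bd
  v_ac_ad := h.v_ab_ad
  v_ac_bc := h.v_ab_bc
  v_ac_bd := h.v_ab_cd
  v_ac_cd := h.v_ab_bd
  v_ad_bc := h.v_ad_bc
  v_ad_bd := h.v_ad_cd
  v_ad_cd := h.v_ad_bd
  v_bc_bd := h.v_bc_cd
  v_bc_cd := h.v_bc_bd
  v_bd_cd := fun z h₁ h₂ => h.v_bd_cd z h₂ h₁

/-- Relabeling the corners `a ↔ c`. [folklore] -/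
theorem K4Sep.swap_ac (h : K4Sep Qab Qac Qad Qbc Qbd Qcd a b c d) :
    K4Sep Qbc Qac Qcd Qab Qbd Qad c b a d where
  d_ab_ac := h.d_ac_bc.symm
  d_ab_ad := h.d_bc_cd
  d_ab_bc := h.d_ab_bc.symm
  d_ab_bd := h.d_bc_bd
  d_ab_cd := h.d_ad_bc.symm
  d_ac_ad := h.d_ac_cd
  d_ac_bc := h.d_ab_ac.symm
  d_ac_bd := h.d_ac_bd
  d_ac_cd := h.d_ac_ad
  d_ad_bc := h.d_ab_cd.symm
  d_ad_bd := h.d_bd_cd.symm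
  d_ad_cd := h.d_ad_cd.symm
  d_bc_bd := h.d_ab_bd
  d_bc_cd := h.d_ab_ad
  d_bd_cd := h.d_ad_bd.symm
  v_ab_ac := fun z h₁ h₂ => h.v_ac_bc z h₂ h₁
  v_ab_ad := h.v_bc_cd
  v_ab_bc := fun z h₁ h₂ => h.v_ab_bc z h₂ h₁
  v_ab_bd := h.v_bc_bd
  v_ab_cd := fun z h₁ h₂ => h.v_ad_bc z h₂ h₁
  v_ac_ad := h.v_ac_cd
  v_ac_bc := fun z h₁ h₂ => h.v_ab_ac z h₂ h₁
  v_ac_bd := h.v_ac_bd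
  v_ac_cd := h.v_ac_ad
  v_ad_bc := fun z h₁ h₂ => h.v_ab_cd z h₂ h₁
  v_ad_bd := fun z h₁ h₂ => h.v_bd_cd z h₂ h₁
  v_ad_cd := fun z h₁ h₂ => h.v_ad_cd z h₂ h₁
  v_bc_bd := h.v_ab_bd
  v_bc_cd := h.v_ab_ad
  v_bd_cd := fun z h₁ h₂ => h.v_ad_bd z h₂ h₁

/-- **Shrinking the slot `ab` to a single edge keeps the `K₄` side conditions** (the one-sided reduction step of the SP(𝒦) placement
lemmas: census g41 drafts/README; `FK.oneSided_of_shrunk`). [folklore] -/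
theorem K4Sep.shrink_ab (h : K4Sep Qab Qac Qad Qbc Qbd Qcd a b c d) (hac : IsKNet Qac a c) (had : IsKNet Qad a d)
    (hbc : IsKNet Qbc b c) (hbd : IsKNet Qbd b d) : K4Sep {s(a, b)} Qac Qad Qbc Qbd Qcd a b c d := by
  have hb_ac : ¬ ∃ e ∈ Qac, b ∈ e := fun hh => hbc.ne (h.v_ac_bc b hh hbc.left_mem)
  have hb_ad : ¬ ∃ e ∈ Qad, b ∈ e := fun hh => hbd.ne (h.v_ad_bd b hh hbd.left_mem)
  have ha_bc : ¬ ∃ e ∈ Qbc, a ∈ e := fun hh => hac.ne (h.v_ac_bc a hac.left_mem hh)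
  have ha_bd : ¬ ∃ e ∈ Qbd, a ∈ e := fun hh => had.ne (h.v_ad_bd a had.left_mem hh)
  have ha_cd : ¬ ∃ e ∈ Qcd, a ∈ e := fun hh => hac.ne (h.v_ac_cd a hac.left_mem hh)
  have hb_cd : ¬ ∃ e ∈ Qcd, b ∈ e := fun hh => hbc.ne (h.v_bc_cd b hbc.left_mem hh)
  have nm : ∀ {Q : Finset (Sym2 V)}, (¬ ∃ e ∈ Q, a ∈ e) ∨ (¬ ∃ e ∈ Q, b ∈ e) → Disjoint ({s(a, b)} : Finset (Sym2 V)) Q := by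
    intro Q hq
    refine Finset.disjoint_singleton_left.2 fun he => ?_
    rcases hq with hq | hq
    · exact hq ⟨_, he, Sym2.mem_mk_left _ _⟩
    · exact hq ⟨_, he, Sym2.mem_mk_right _ _⟩
  have sp : ∀ {z : V}, (∃ e ∈ ({s(a, b)} : Finset (Sym2 V)), z ∈ e) → z = a ∨ z = b := fun ⟨e, he, hze⟩ => by
    rw [Finset.mem_singleton] at he; subst he; exact Sym2.mem_iff.1 hze
  exact
  { d_ab_ac := nm (Or.inr hb_ac)
    d_ab_ad := nm (Or.inr hb_ad)
    d_ab_bc := nm (Or.inl ha_bc)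
    d_ab_bd := nm (Or.inl ha_bd)
    d_ab_cd := nm (Or.inl ha_cd)
    d_ac_ad := h.d_ac_ad
    d_ac_bc := h.d_ac_bc
    d_ac_bd := h.d_ac_bd
    d_ac_cd := h.d_ac_cd
    d_ad_bc := h.d_ad_bc
    d_ad_bd := h.d_ad_bd
    d_ad_cd := h.d_ad_cd
    d_bc_bd := h.d_bc_bd
    d_bc_cd := h.d_bc_cd
    d_bd_cd := h.d_bd_cd
    v_ab_ac := fun z hz h' => (sp hz).elim id fun hb => absurd (hb ▸ h') hb_ac
    v_ab_ad := fun z hz h' => (sp hz).elim id fun hb => absurd (hb ▸ h') hb_ad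
    v_ab_bc := fun z hz h' => (sp hz).elim (fun ha => absurd (ha ▸ h') ha_bc) id
    v_ab_bd := fun z hz h' => (sp hz).elim (fun ha => absurd (ha ▸ h') ha_bd) id
    v_ab_cd := fun z hz h' => (sp hz).elim (fun ha => ha_cd (ha ▸ h')) fun hb => hb_cd (hb ▸ h')
    v_ac_ad := h.v_ac_ad
    v_ac_bc := h.v_ac_bc
    v_ac_bd := h.v_ac_bd
    v_ac_cd := h.v_ac_cd
    v_ad_bc := h.v_ad_bc
    v_ad_bd := h.v_ad_bd
    v_ad_cd := h.v_ad_cd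
    v_bc_bd := h.v_bc_bd
    v_bc_cd := h.v_bc_cd
    v_bd_cd := h.v_bd_cd }


end K4

/-- **A bridge in parallel with a 𝒦-network is a `K₄` with six slots**: `E₁ = BRIDGE(Qac, Qad, Qbc, Qbd, Qcd; x, y)`, `E₂` between
`x, y`, edge-disjoint, meeting `E₁` only at the poles ⇒ `K4Sep E₂ Qac Qad Qbc Qbd Qcd x y c d`. [folklore] -/
theorem k4Sep_of_bridge_par {Qac Qad Qbc Qbd Qcd E₂ : Finset (Sym2 V)} {x y c d : V}
    (hac : IsKNet Qac x c) (had : IsKNet Qad x d) (hbc : IsKNet Qbc y c) (hbd : IsKNet Qbd y d)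
    (hsep : BridgeSep Qac Qad Qbc Qbd Qcd x y c d) (hd : Disjoint (Qac ∪ Qad ∪ Qbc ∪ Qbd ∪ Qcd) E₂)
    (hV : ∀ z : V, (∃ e ∈ Qac ∪ Qad ∪ Qbc ∪ Qbd ∪ Qcd, z ∈ e) → (∃ e ∈ E₂, z ∈ e) → z = x ∨ z = y) :
    K4Sep E₂ Qac Qad Qbc Qbd Qcd x y c d := by
  have sac : Qac ⊆ Qac ∪ Qad ∪ Qbc ∪ Qbd ∪ Qcd := fun e he => by simp only [Finset.mem_union]; exact Or.inl (Or.inl (Or.inl (Or.inl he)))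
  have sad : Qad ⊆ Qac ∪ Qad ∪ Qbc ∪ Qbd ∪ Qcd := fun e he => by simp only [Finset.mem_union]; exact Or.inl (Or.inl (Or.inl (Or.inr he)))
  have sbc : Qbc ⊆ Qac ∪ Qad ∪ Qbc ∪ Qbd ∪ Qcd := fun e he => by simp only [Finset.mem_union]; exact Or.inl (Or.inl (Or.inr he))
  have sbd : Qbd ⊆ Qac ∪ Qad ∪ Qbc ∪ Qbd ∪ Qcd := fun e he => by simp only [Finset.mem_union]; exact Or.inl (Or.inr he)
  have scd : Qcd ⊆ Qac ∪ Qad ∪ Qbc ∪ Qbd ∪ Qcd := fun e he => Finset.mem_union_right _ he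
  have sl : ∀ {Q : Finset (Sym2 V)}, Q ⊆ Qac ∪ Qad ∪ Qbc ∪ Qbd ∪ Qcd → ∀ z : V, (∃ e ∈ E₂, z ∈ e) → (∃ e ∈ Q, z ∈ e) →
      z = x ∨ z = y := fun hQ z h₂ ⟨e, he, hze⟩ => hV z ⟨e, hQ he, hze⟩ h₂
  have hyac : ¬ ∃ e ∈ Qac, y ∈ e := fun h => hbc.ne (hsep.v_ac_bc y h hbc.left_mem)
  have hyad : ¬ ∃ e ∈ Qad, y ∈ e := fun h => hbd.ne (hsep.v_ad_bd y h hbd.left_mem)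
  have hxbc : ¬ ∃ e ∈ Qbc, x ∈ e := fun h => hac.ne (hsep.v_ac_bc x hac.left_mem h)
  have hxbd : ¬ ∃ e ∈ Qbd, x ∈ e := fun h => had.ne (hsep.v_ad_bd x had.left_mem h)
  have hxcd : ¬ ∃ e ∈ Qcd, x ∈ e := fun h => hac.ne (hsep.v_ac_cd x hac.left_mem h)
  have hycd : ¬ ∃ e ∈ Qcd, y ∈ e := fun h => hbc.ne (hsep.v_bc_cd y hbc.left_mem h)
  exact
  { d_ab_ac := (Finset.disjoint_of_subset_left sac hd).symm
    d_ab_ad := (Finset.disjoint_of_subset_left sad hd).symm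
    d_ab_bc := (Finset.disjoint_of_subset_left sbc hd).symm
    d_ab_bd := (Finset.disjoint_of_subset_left sbd hd).symm
    d_ab_cd := (Finset.disjoint_of_subset_left scd hd).symm
    d_ac_ad := hsep.d_ac_ad
    d_ac_bc := hsep.d_ac_bc
    d_ac_bd := hsep.d_ac_bd
    d_ac_cd := hsep.d_ac_cd
    d_ad_bc := hsep.d_ad_bc
    d_ad_bd := hsep.d_ad_bd
    d_ad_cd := hsep.d_ad_cd
    d_bc_bd := hsep.d_bc_bd
    d_bc_cd := hsep.d_bc_cd
    d_bd_cd := hsep.d_bd_cd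
    v_ab_ac := fun z h₂ h => (sl sac z h₂ h).elim id fun hz => absurd (hz ▸ h) hyac
    v_ab_ad := fun z h₂ h => (sl sad z h₂ h).elim id fun hz => absurd (hz ▸ h) hyad
    v_ab_bc := fun z h₂ h => (sl sbc z h₂ h).elim (fun hz => absurd (hz ▸ h) hxbc) id
    v_ab_bd := fun z h₂ h => (sl sbd z h₂ h).elim (fun hz => absurd (hz ▸ h) hxbd) id
    v_ab_cd := fun z h₂ h => (sl scd z h₂ h).elim (fun hz => hxcd (hz ▸ h)) fun hz => hycd (hz ▸ h)
    v_ac_ad := hsep.v_ac_ad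
    v_ac_bc := hsep.v_ac_bc
    v_ac_bd := hsep.v_ac_bd
    v_ac_cd := hsep.v_ac_cd
    v_ad_bc := hsep.v_ad_bc
    v_ad_bd := hsep.v_ad_bd
    v_ad_cd := hsep.v_ad_cd
    v_bc_bd := hsep.v_bc_bd
    v_bc_cd := hsep.v_bc_cd
    v_bd_cd := hsep.v_bd_cd }

/-- **A `K₄` with six 𝒦-slots is a 𝒦-network between `a` and `b`**: the slot `ab` in parallel with the bridge of the other five.
[folklore] -/
theorem K4Sep.isKNet {Qab Qac Qad Qbc Qbd Qcd : Finset (Sym2 V)} {a b c d : V} (h : K4Sep Qab Qac Qad Qbc Qbd Qcd a b c d)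
    (hab : IsKNet Qab a b) (hac : IsKNet Qac a c) (had : IsKNet Qad a d) (hbc : IsKNet Qbc b c) (hbd : IsKNet Qbd b d)
    (hcd : IsKNet Qcd c d) : IsKNet (Qab ∪ (Qac ∪ Qad ∪ Qbc ∪ Qbd ∪ Qcd)) a b := by
  refine IsKNet.parallel hab (IsKNet.bridge hac had hbc hbd hcd h.toBridgeSep) ?_ ?_
  · exact Finset.disjoint_union_right.2 ⟨Finset.disjoint_union_right.2 ⟨Finset.disjoint_union_right.2
      ⟨Finset.disjoint_union_right.2 ⟨h.d_ab_ac, h.d_ab_ad⟩, h.d_ab_bc⟩, h.d_ab_bd⟩, h.d_ab_cd⟩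
  · intro z hz₁ hz₂
    obtain ⟨f, hf, hzf⟩ := hz₂
    simp only [Finset.mem_union] at hf
    rcases hf with (((hf | hf) | hf) | hf) | hf
    · exact Or.inl (h.v_ab_ac z hz₁ ⟨f, hf, hzf⟩)
    · exact Or.inl (h.v_ab_ad z hz₁ ⟨f, hf, hzf⟩)
    · exact Or.inr (h.v_ab_bc z hz₁ ⟨f, hf, hzf⟩)
    · exact Or.inr (h.v_ab_bd z hz₁ ⟨f, hf, hzf⟩)
    · exact (h.v_ab_cd z hz₁ ⟨f, hf, hzf⟩).elim

end FK

end Summit.CriticalPhenomena.PercolationContinuityZ3.Theorems
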